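import Literature.AlgebraicGeometry.HodgeTheory.GAGARegularOfUnitTimesRational
import Literature.AlgebraicGeometry.HodgeTheory.GAGALinEquivOfMatchedSections
import Literature.AlgebraicGeometry.HodgeTheory.CartierCocycleChernCalculus
import Literature.AlgebraicGeometry.HodgeTheory.TautologicalCocycleLinEquivUnits
import Literature.AlgebraicGeometry.Motives.CartierDivisorPoles
import Literature.AlgebraicGeometry.Motives.CartierDivisorBlowupExcess
import Literature.AlgebraicGeometry.Motives.CartierDivisorClassPullback
import Literature.AlgebraicGeometry.Motives.VarietiesRegularProofs
import Literature.AlgebraicGeometry.Resolution.RegularLocalRingsUFD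
import HarnessLib

/-!
# GAGA for line bundles: injectivity on `Pic` — `𝒪_X(D)^an ≅ 𝒪_X(E)^an` holomorphically ⇒ `D ∼ E`

J.-P. Serre, *Géométrie algébrique et géométrie analytique*, Ann. Inst. Fourier 6 (1956), n° 20
Prop. 18: for `X` projective over `ℂ` the map `H¹(X, GL_r(𝒪_X)) → H¹(X^h, GL_r(𝒪_{X^h}))` is
BIJECTIVE. The tree proves the surjectivity for `r = 1` (`GAGALineBundlesHolds`,
`serreGAGA_lineCocycle_iso_cartierDivisorCocycle_holds`: every holomorphic line cocycle on `X^an` is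
`𝒪_X(D)^an`) and the easy converse `D ∼ E ⇒ 𝒪_X(D)^an ≅ 𝒪_X(E)^an`
(`CartierCocycleChernCalculus.analyticallyEquivalent_cartierDivisorCocycle_of_isUnitAt`). This file
proves the **injectivity for `r = 1`** on the tree's carriers: for `X` smooth projective over `ℂ`
with analytification `φ : M → X(ℂ)` and Cartier divisors `D`, `D'` on `X`, a holomorphic
isomorphism of cocycles `𝒪_X(D)^an ≅ 𝒪_X(D')^an` (`SmoothComplexVectorBundle.AnalyticallyEquivalent`,
Fritzsche–Grauert IV §2 condition (C)) forces `D ∼ D'` (`CartierDivisor.LinEquiv`, Görtz–Wedhorn I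
(11.9)): `linEquiv_of_analyticallyEquivalent_cartierDivisorCocycle`. With the surjectivity this is
`Pic X ≅ Pic X^an` (Serre, loc. cit.; Griffiths–Harris, Ch. 1 §3: «`M(X) = K(X)`»).

## The proof (road (b5) of the cell's B1 census: junk graph + Chow + closed graph + Hartogs)

Let `λ_{a i}` be the holomorphic units of the cocycle isomorphism on `φ⁻¹((U_i ∩ V_a)(ℂ))`,
`λ_{a i} (f_i/f_j)^an = (f'_a/f'_b)^an λ_{b j}`, and `r_{i a} = f_i / f'_a ∈ K(X)` the local equations
of `D - D'`. On the dense open `T = {x | r_{i a} ∈ 𝒪_{X,x}^×}` (independent of `(i, a)`) the products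
`ψ = λ_{a i} · r_{i a}^an` glue to ONE holomorphic function (condition (C)), which is locally
(holomorphic unit) · (rational): at any `y ∈ X` a uniform denominator `b` of `r_{i a}` on a
neighbourhood `W` (`Motives/CartierDivisorPoles`: `exists_isDenomAt` on the factorial stalks of the
smooth `X`, `IsDenomAt.exists_forall_mem_nhds`) gives sections `a = b r`, `b ∈ Γ(X, W)` with
`T ∩ W = D(a) ∩ D(b)` (`IsDenomAt.isRegularAt_iff`: `r` regular ⇔ `b` a unit) and `ψ · b = λ · a`.
Hence `ψ` is a REGULAR function `c` on `T` (`GAGARegularOfUnitTimesRational`,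
`exists_section_eval_eq_of_locally_unit_mul_div`: junk graph, Chow, closed graph over the normal `T`).
Finally `λ_{a i} = (c / r_{i a})^an` is CONTINUOUS and nowhere zero on `(U_i ∩ V_a)(ℂ)`, so the
rational functions `c / r_{i a}` and `r_{i a} / c` are regular on `U_i ∩ V_a` (algebraic Hartogs for
normal varieties, `RiemannExistenceContinuousRationalNormal.isRegularAt_of_continuous_of_normal`), i.e.
`f_i · c⁻¹ / f'_a ∈ 𝒪_{X,x}^×` for all `x ∈ U_i ∩ V_a`: `D ∼ D'` with `h = c⁻¹`.

Everything here is proved; no definitions, no named facts.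

## References

* [SerreGAGA1956] J.-P. Serre, Géométrie algébrique et géométrie analytique, Ann. Inst. Fourier 6
  (1956), n° 19 Prop. 13, n° 20 Prop. 18 and Remarque 1 (pp. 29–32).
* [GriffithsHarrisPrinciples1978] P. Griffiths, J. Harris, Principles of Algebraic Geometry (1978),
  Ch. 1 §3, pp. 167–171.
* [GortzWedhorn2020] U. Görtz, T. Wedhorn, Algebraic Geometry I, 2nd ed. (2020), (11.9),
  Prop. 11.21, Thm. 6.45.
* [FritzscheGrauert2002] K. Fritzsche, H. Grauert, From Holomorphic Functions to Complex Manifolds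
  (2002), Ch. IV §2 (condition (C)).
-/

noncomputable section

open scoped Manifold ContDiff Topology
open CategoryTheory AlgebraicGeometry Set
open Literature.AlgebraicGeometry.Motives
open Literature.AlgebraicGeometry.Motives.AlgPoints (evalOrZero evalOrZero_of_mem)
open Literature.AlgebraicGeometry.Motives.RatFn
open Literature.Geometry.Kaehler
open Literature.NumberTheory.Transcendental
open Literature.AlgebraicGeometry.FundamentalGroup

namespace Literature.AlgebraicGeometry.HodgeTheory

section Main

variable {n : ℕ} {X : SchemeOver ℂ} [IsIntegral X.left]
  {E : Type*} [NormedAddCommGroup E] [NormedSpace ℂ E] [FiniteDimensional ℂ E]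
  {M : Type*} [TopologicalSpace M] [ChartedSpace E M] [IsManifold 𝓘(ℂ, E) ω M] [IsManifold 𝓘(ℝ, E) ∞ M]
  {φ : M → ComplexPoints X}

/-- A `1 × 1` matrix product, entrywise. [folklore] -/
private theorem matrix_one_mul_apply (A B : Matrix (Fin 1) (Fin 1) ℂ) : (A * B) 0 0 = A 0 0 * B 0 0 := by
  simp [Matrix.mul_apply]

/-- A `1 × 1` unit matrix has non-zero entry. [folklore] -/
private theorem matrix_one_entry_ne_zero {A : Matrix (Fin 1) (Fin 1) ℂ} (hA : IsUnit A) : A 0 0 ≠ 0 := by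
  rw [Matrix.isUnit_iff_isUnit_det, Matrix.det_unique] at hA
  exact hA.ne_zero

/-- At a complex point `P ∈ O(ℂ)`, a rational function represented by a section `σ ∈ Γ(X, O)` is a unit
of `𝒪_{X,P}` iff `σ(P) ≠ 0`. [cite: GortzWedhorn2020, (7.11) and Prop. 3.29 (p. 102)] -/
theorem isUnitAt_ofSection_iff_evalOrZero_ne_zero {O : X.left.Opens} (σ : Γ(X.left, O))
    {P : ComplexPoints X} (hP : P.pt ∈ O) :
    IsUnitAt P.pt (ofSection (genericPoint_mem_of_mem hP) σ) ↔ evalOrZero O σ P ≠ 0 := by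
  rw [isUnitAt_ofSection_iff hP, AlgPoints.pt_mem_basicOpen_iff P hP, evalOrZero_of_mem _ hP]

/-- **GAGA for line bundles, injectivity on `Pic` (Serre 1956, n° 20 Prop. 18 for `r = 1`, injective
half).** Let `X` be smooth projective over `ℂ` with analytification `φ : M → X(ℂ)` (holomorphic atlas),
and `D`, `D'` Cartier divisors on `X`. If the analytified line bundles `𝒪_X(D)^an`, `𝒪_X(D')^an`
(`cartierDivisorCocycle`) are holomorphically isomorphic as cocycles
(`SmoothComplexVectorBundle.AnalyticallyEquivalent`), then `D ∼ D'` (`CartierDivisor.LinEquiv`).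
Proof: junk graph + Chow + closed graph (`exists_section_eval_eq_of_locally_unit_mul_div`, applied to
`ψ = λ_{a i} (f_i/f'_a)^an` on `T = {f_i/f'_a unit}` with uniform denominators from
`Motives/CartierDivisorPoles`) makes `ψ` a regular function `c` on `T`; algebraic Hartogs on the
normal `X` (`isRegularAt_of_continuous_of_normal`) makes `c f'_a/f_i` a unit on `U_i ∩ V_a`; take
`h = c⁻¹`. [cite: SerreGAGA1956, n° 20 Prop. 18 and Remarque 1]
[cite: GriffithsHarrisPrinciples1978, Ch. 1 §3 pp. 167–171] [cite: GortzWedhorn2020, Prop. 11.21 (p. 374)] -/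
theorem linEquiv_of_analyticallyEquivalent_cartierDivisorCocycle (hX : IsSmoothProjective n X)
    (hφ : IsAnalytification E X n φ) (D D' : CartierDivisor X.left)
    (h : SmoothComplexVectorBundle.AnalyticallyEquivalent (cartierDivisorCocycle hφ D)
      (cartierDivisorCocycle hφ D')) :
    D.LinEquiv D' := by
  classical
  obtain ⟨Φ, hΦ⟩ := h
  haveI : SmoothOfRelativeDimension n X.hom := hX.smoothOfRelativeDimension
  haveI : Smooth X.hom := SmoothOfRelativeDimension.smooth n X.hom
  haveI : LocallyOfFiniteType X.hom := inferInstance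
  haveI : IsLocallyNoetherian X.left := LocallyOfFiniteType.isLocallyNoetherian X.hom
  have hregX : ∀ x : X.left, IsRegularLocalRing (X.left.presheaf.stalk x) := fun x ↦
    Literature.AlgebraicGeometry.Motives.isRegularLocalRing_stalk_of_smoothOfRelativeDimension X.hom n x
  have hUFD : ∀ x : X.left, UniqueFactorizationMonoid (X.left.presheaf.stalk x) := fun x ↦
    Literature.AlgebraicGeometry.Resolution.Matsumura1987_20_3_holds _ (hregX x)
  /- the units `λ_{a i}` -/
  set u : D.ι → D'.ι → M → ℂ := fun i a m ↦ Φ.map a i m 0 0 with hu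
  have hu_ne : ∀ i a m, (φ m).pt ∈ D.U i → (φ m).pt ∈ D'.U a → u i a m ≠ 0 := fun i a m hi ha ↦
    matrix_one_entry_ne_zero (Φ.isUnit_map a i m ⟨hi, ha⟩)
  have hu_hol : ∀ i a, MDifferentiableOn 𝓘(ℂ, E) 𝓘(ℂ, ℂ) (u i a)
      (φ ⁻¹' {P | P.pt ∈ D.U i ⊓ D'.U a}) := fun i a ↦
    (hΦ a i 0 0).mono fun m hm ↦ ⟨hm.1, hm.2⟩
  -- condition (C), entrywise: `u_{ia} g_{ij} = g'_{ab} u_{jb}`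
  have hC : ∀ i j a b m, (φ m).pt ∈ D.U i → (φ m).pt ∈ D.U j → (φ m).pt ∈ D'.U a → (φ m).pt ∈ D'.U b →
      u i a m * evalOrZero (D.U i ⊓ D.U j) (D.transFun i j) (φ m) =
        evalOrZero (D'.U a ⊓ D'.U b) (D'.transFun a b) (φ m) * u j b m := by
    intro i j a b m hi hj ha hb
    have h := Φ.map_mul_coordChange a b i j m ⟨⟨hi, hj⟩, ha, hb⟩
    have h' := congrArg (fun A : Matrix (Fin 1) (Fin 1) ℂ ↦ A 0 0) h
    simp only [matrix_one_mul_apply, cartierDivisorCocycle_coordChange_apply] at h'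
    exact h'
  /- the divisor `D - D'`, its unit locus `T`, the local ratios `r_{ia} = f_i/f'_a` -/
  set F : CartierDivisor X.left := D.sub D' with hF
  set T : X.left.Opens := F.nonvanishingOpens 1 with hT
  set r : D.ι → D'.ι → X.left.functionField := fun i a ↦ D.f i / D'.f a with hr
  have hr_ne : ∀ i a, r i a ≠ 0 := fun i a ↦ div_ne_zero (D.f_ne_zero i) (D'.f_ne_zero a)
  have hT_iff : ∀ {i a} {x : X.left}, x ∈ D.U i → x ∈ D'.U a → (x ∈ T ↔ IsUnitAt x (r i a)) := by
    intro i a x hi ha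
    change x ∈ F.nonvanishing 1 ↔ _
    rw [CartierDivisor.mem_nonvanishing_iff (D := F) (i := (i, a)) (show x ∈ F.U (i, a) from ⟨hi, ha⟩),
      mul_one]
    exact Iff.rfl
  -- the value function `ρ_{ia}` of `r_{ia}` on `O_{ia} = T ∩ U_i ∩ V_a`
  set O : D.ι → D'.ι → X.left.Opens := fun i a ↦ T ⊓ (D.U i ⊓ D'.U a) with hO
  have hreg : ∀ i a, ∀ y ∈ O i a, IsRegularAt y (r i a) := fun i a y hy ↦
    ((hT_iff hy.2.1 hy.2.2).1 hy.1).isRegularAt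
  set ρ : D.ι → D'.ι → ComplexPoints X → ℂ := fun i a P ↦
    if hg : genericPoint X.left ∈ O i a then evalOrZero (O i a) (sectionOf hg (r i a) (hreg i a)) P
    else 0 with hρ
  have hρ_of_mem : ∀ {i a} {P : ComplexPoints X} (hP : P.pt ∈ O i a),
      ρ i a P = evalOrZero (O i a) (sectionOf (genericPoint_mem_of_mem hP) (r i a) (hreg i a)) P := by
    intro i a P hP
    rw [hρ]
    exact dif_pos (genericPoint_mem_of_mem hP)
  have hρ_ne : ∀ {i a} {P : ComplexPoints X} (hP : P.pt ∈ O i a), ρ i a P ≠ 0 := by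
    intro i a P hP
    rw [hρ_of_mem hP]
    exact evalOrZero_sectionOf_ne_zero _ (hreg i a) hP ((hT_iff hP.2.1 hP.2.2).1 hP.1)
  -- compatibility on overlaps: `u_{ia} ρ_{ia} = u_{jb} ρ_{jb}`
  have hcompat : ∀ {i j a b} {m : M}, (φ m).pt ∈ O i a → (φ m).pt ∈ O j b →
      u i a m * ρ i a (φ m) = u j b m * ρ j b (φ m) := by
    intro i j a b m hia hjb
    have hi := hia.2.1; have ha := hia.2.2; have hj := hjb.2.1; have hb := hjb.2.2
    -- `ρ_{ia} g'_{ab} = ρ_{jb} g_{ij}` (an identity in `K(X)`)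
    have hval : ρ i a (φ m) * evalOrZero (D'.U a ⊓ D'.U b) (D'.transFun a b) (φ m) =
        ρ j b (φ m) * evalOrZero (D.U i ⊓ D.U j) (D.transFun i j) (φ m) := by
      rw [hρ_of_mem hia, hρ_of_mem hjb]
      refine evalOrZero_mul_eq_mul_of_ofSection _ _ _ _ hia ⟨ha, hb⟩ hjb ⟨hi, hj⟩ ?_
      rw [ofSection_sectionOf, ofSection_sectionOf, CartierDivisor.ofSection_transFun,
        CartierDivisor.ofSection_transFun]
      have h1 := D.f_ne_zero j; have h2 := D'.f_ne_zero a; have h3 := D'.f_ne_zero b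
      rw [hr]
      field_simp
    have hgij : evalOrZero (D.U i ⊓ D.U j) (D.transFun i j) (φ m) ≠ 0 := by
      intro h0
      have h1 := D.evalOrZero_transFun_mul_symm (P := φ m) hi hj
      rw [h0, zero_mul] at h1
      exact zero_ne_one h1
    have hC' := hC i j a b m hi hj ha hb
    have key : u i a m * ρ i a (φ m) * evalOrZero (D.U i ⊓ D.U j) (D.transFun i j) (φ m) =
        u j b m * ρ j b (φ m) * evalOrZero (D.U i ⊓ D.U j) (D.transFun i j) (φ m) := by
      linear_combination (ρ i a (φ m)) * hC' + (u j b m) * hval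
    exact mul_right_cancel₀ hgij key
  /- the glued function `ψ` -/
  set i₀ : M → D.ι := fun m ↦ (D.covers (φ m).pt).choose with hi₀
  set a₀ : M → D'.ι := fun m ↦ (D'.covers (φ m).pt).choose with ha₀
  have hi₀m : ∀ m, (φ m).pt ∈ D.U (i₀ m) := fun m ↦ (D.covers (φ m).pt).choose_spec
  have ha₀m : ∀ m, (φ m).pt ∈ D'.U (a₀ m) := fun m ↦ (D'.covers (φ m).pt).choose_spec
  set g : M → ℂ := fun m ↦ u (i₀ m) (a₀ m) m * ρ (i₀ m) (a₀ m) (φ m) with hg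
  have hg_eq : ∀ {i a} {m : M}, (φ m).pt ∈ O i a → g m = u i a m * ρ i a (φ m) := by
    intro i a m hm
    rw [hg]
    exact hcompat ⟨hm.1, hi₀m m, ha₀m m⟩ hm
  /- the local data: uniform denominators -/
  have H : ∀ m : M, ∃ (W : X.left.Opens) (α β : Γ(X.left, W)) (v : M → ℂ), (φ m).pt ∈ W ∧
      MDifferentiableOn 𝓘(ℂ, E) 𝓘(ℂ, ℂ) v (φ ⁻¹' {P | P.pt ∈ W}) ∧
      ∀ m', (φ m').pt ∈ W → v m' ≠ 0 ∧
        ((φ m').pt ∈ T ↔ evalOrZero W α (φ m') ≠ 0 ∧ evalOrZero W β (φ m') ≠ 0) ∧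
        ((φ m').pt ∈ T → g m' * evalOrZero W β (φ m') = v m' * evalOrZero W α (φ m')) := by
    intro m₀
    set y := (φ m₀).pt with hy
    obtain ⟨i, hi⟩ := D.covers y
    obtain ⟨a, ha⟩ := D'.covers y
    obtain ⟨b₀, hb₀⟩ := exists_isDenomAt (hUFD y) (r i a)
    obtain ⟨W₀, b, hyW₀, hb0, hden⟩ := hb₀.exists_forall_mem_nhds
    set W : X.left.Opens := W₀ ⊓ (D.U i ⊓ D'.U a) with hW
    have hyW : y ∈ W := ⟨hyW₀, hi, ha⟩
    have hgen : genericPoint X.left ∈ W := genericPoint_mem_of_mem hyW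
    have hbreg : ∀ y' ∈ W, IsRegularAt y' b := fun y' hy' ↦ (hden y' hy'.1).isRegularAt
    have hareg : ∀ y' ∈ W, IsRegularAt y' (b * r i a) := fun y' hy' ↦ (hden y' hy'.1).isRegularAt_mul
    set β : Γ(X.left, W) := sectionOf hgen b hbreg with hβ
    set α : Γ(X.left, W) := sectionOf hgen (b * r i a) hareg with hα
    -- `T ∩ W = D(α) ∩ D(β)`
    have hunit_iff : ∀ y' ∈ W, (IsUnitAt y' (r i a) ↔ IsUnitAt y' (b * r i a) ∧ IsUnitAt y' b) := by
      intro y' hy'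
      constructor
      · intro hr'
        have hb' : IsUnitAt y' b := ((hden y' hy'.1).isRegularAt_iff).1 hr'.isRegularAt
        exact ⟨hb'.mul hr', hb'⟩
      · rintro ⟨hbr, hb'⟩
        have := hbr.div hb'
        rwa [mul_div_cancel_left₀ _ hb0] at this
    refine ⟨W, α, β, u i a, hyW, (hu_hol i a).mono fun m hm ↦ hm.2, fun m' hm' ↦ ⟨?_, ?_, ?_⟩⟩
    · exact hu_ne i a m' hm'.2.1 hm'.2.2
    · rw [hT_iff hm'.2.1 hm'.2.2, hunit_iff _ hm',
        ← isUnitAt_ofSection_iff_evalOrZero_ne_zero α hm', ← isUnitAt_ofSection_iff_evalOrZero_ne_zero β hm',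
        hα, hβ, ofSection_sectionOf, ofSection_sectionOf]
    · intro hT'
      have hO' : (φ m').pt ∈ O i a := ⟨hT', hm'.2.1, hm'.2.2⟩
      rw [hg_eq hO', mul_assoc]
      congr 1
      -- `ρ(P) β(P) = α(P)`: `r · b = b r` in `K(X)`
      rw [hρ_of_mem hO']
      have := evalOrZero_eq_mul_of_ofSection α (sectionOf (genericPoint_mem_of_mem hO') (r i a) (hreg i a)) β
        (P := φ m') hm' hO' hm' (by
          rw [hα, hβ, ofSection_sectionOf, ofSection_sectionOf, ofSection_sectionOf, mul_comm])
      exact this.symm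
  /- `ψ` is a regular function `c` on `T` -/
  obtain ⟨c, hc⟩ := exists_section_eval_eq_of_locally_unit_mul_div hX hφ T g H
  -- `T` contains the generic point, and `c ≠ 0` as a rational function
  obtain ⟨x₀⟩ : Nonempty X.left := inferInstance
  obtain ⟨i₁, hi₁⟩ := D.covers x₀
  obtain ⟨a₁, ha₁⟩ := D'.covers x₀
  have hTgen : genericPoint X.left ∈ T :=
    (hT_iff (genericPoint_mem_of_mem hi₁) (genericPoint_mem_of_mem ha₁)).2 (isUnitAt_genericPoint (hr_ne i₁ a₁))
  set hc' : X.left.functionField := ofSection hTgen c with hhc'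
  -- values of `c` on `T(ℂ)`: `c(P) = u ρ`
  have hc_val : ∀ {i a} {P : ComplexPoints X} (hP : P.pt ∈ O i a),
      evalOrZero T c P = u i a (hφ.homeomorph.symm P) * ρ i a P := by
    intro i a P hP
    have hφP : φ (hφ.homeomorph.symm P) = P := hφ.homeomorph.apply_symm_apply P
    have hP' : (φ (hφ.homeomorph.symm P)).pt ∈ O i a := by
      rw [hφP]
      exact hP
    have h1 := hc (hφ.homeomorph.symm P) (by rw [hφP]; exact hP.1)
    rw [hφP] at h1
    rw [h1, hg_eq hP', hφP]
  -- `c ≠ 0` as a rational function: `T(ℂ)` has a point (Jacobson), where `c = λ ρ ≠ 0`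
  have hc'_ne : hc' ≠ 0 := by
    haveI : JacobsonSpace X.left := LocallyOfFiniteType.jacobsonSpace X.hom
    obtain ⟨t, htT, htcl⟩ := nonempty_inter_closedPoints
      (⟨genericPoint X.left, hTgen⟩ : (T : Set X.left).Nonempty) T.isOpen.isLocallyClosed
    obtain ⟨P, hP⟩ := AlgPoints.exists_pt_eq_of_isClosed (X := X) (L := ℂ) t htcl
    have hPT : P.pt ∈ T := by
      rw [hP]
      exact htT
    obtain ⟨i, hi⟩ := D.covers P.pt
    obtain ⟨a, ha⟩ := D'.covers P.pt
    have hPO : P.pt ∈ O i a := ⟨hPT, hi, ha⟩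
    have hval := hc_val hPO
    intro h0
    have hc0 : c = 0 := by
      refine section_ext fun hU ↦ ?_
      change _ = X.left.presheaf.germ T (genericPoint X.left) hU 0
      rw [map_zero]
      exact h0
    rw [hc0, evalOrZero_of_mem _ hPT, ← AlgPoints.evalRingHom_apply, map_zero] at hval
    have hφP : (φ (hφ.homeomorph.symm P)).pt ∈ D.U i ⊓ D'.U a := by
      rw [show φ (hφ.homeomorph.symm P) = P from hφ.homeomorph.apply_symm_apply P]
      exact ⟨hi, ha⟩
    exact mul_ne_zero (hu_ne i a _ hφP.1 hφP.2) (hρ_ne hPO) hval.symm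
  /- for each `(i, a)`: `c / r_{ia}` is a unit on `U_i ∩ V_a` (algebraic Hartogs) -/
  have hunit : ∀ i a (x : X.left), x ∈ D.U i → x ∈ D'.U a → IsUnitAt x (hc' / r i a) := by
    intro i a x hi ha
    -- an affine neighbourhood `W ⊆ U_i ∩ V_a` of `x`
    obtain ⟨W, hW, hxW, hWle⟩ := exists_isAffineOpen_mem_and_subset (X := X.left) (U := D.U i ⊓ D'.U a)
      (x := x) ⟨hi, ha⟩
    have hWle' : W ≤ D.U i ⊓ D'.U a := hWle
    haveI : Nonempty W := ⟨⟨x, hxW⟩⟩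
    have hWgen : genericPoint X.left ∈ W := genericPoint_mem_of_mem hxW
    haveI := functionField_isFractionRing_of_isAffineOpen X.left W hW
    -- `c / r = β / α` with `α, β ∈ Γ(X, W)`, `α ≠ 0`
    obtain ⟨⟨β, α'⟩, hαβ⟩ := IsLocalization.surj (nonZeroDivisors Γ(X.left, W)) (hc' / r i a)
    set α : Γ(X.left, W) := (α' : Γ(X.left, W)) with hαdef
    have hα0 : α ≠ 0 := nonZeroDivisors.coe_ne_zero α'
    have hαK : algebraMap Γ(X.left, W) X.left.functionField α ≠ 0 :=
      (RatFn.algebraMap_ne_zero_iff (X := X.left) (V := W)).2 hα0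
    have hq : hc' / r i a = algebraMap Γ(X.left, W) X.left.functionField β /
        algebraMap Γ(X.left, W) X.left.functionField α := by
      rw [eq_div_iff hαK]
      exact hαβ
    -- a basic open `D(τ) ⊆ T ∩ W`
    obtain ⟨τ, hτle, hτgen⟩ := hW.exists_basicOpen_le
      (⟨genericPoint X.left, (⟨hTgen, hWgen⟩ : genericPoint X.left ∈ T ⊓ W)⟩ : ↥(T ⊓ W)) hWgen
    have hτ0 : τ ≠ 0 := by
      intro h0
      rw [h0, Scheme.basicOpen_zero] at hτgen
      exact hτgen
    -- the continuous function `G = λ_{a i} ∘ φ⁻¹` on `W(ℂ)` and its inverse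
    set G : ComplexPoints X → ℂ := fun P ↦ u i a (hφ.homeomorph.symm P) with hG
    have hGcont : ContinuousOn G {P | P.pt ∈ W} := by
      have h1 : ContinuousOn (u i a) (φ ⁻¹' {P | P.pt ∈ D.U i ⊓ D'.U a}) := (hu_hol i a).continuousOn
      refine (h1.comp hφ.homeomorph.symm.continuous.continuousOn fun P hP ↦ ?_)
      change (φ (hφ.homeomorph.symm P)).pt ∈ D.U i ⊓ D'.U a
      rw [show φ (hφ.homeomorph.symm P) = P from hφ.homeomorph.apply_symm_apply P]
      exact hWle' hP
    have hGne : ∀ P : ComplexPoints X, P.pt ∈ W → G P ≠ 0 := by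
      intro P hP
      have hP' : (φ (hφ.homeomorph.symm P)).pt ∈ D.U i ⊓ D'.U a := by
        rw [show φ (hφ.homeomorph.symm P) = P from hφ.homeomorph.apply_symm_apply P]; exact hWle' hP
      exact hu_ne i a _ hP'.1 hP'.2
    -- `G · α = β` on `D(α τ)(ℂ)`, hence on `W(ℂ)`
    have hGαβ : ∀ P : ComplexPoints X, P.pt ∈ W → G P * evalOrZero W α P = evalOrZero W β P := by
      refine ContinuousRational.eqOn_of_eqOn_basicOpen (s := α * τ) (mul_ne_zero hα0 hτ0)
        (hGcont.mul (AlgPoints.continuousOn_evalOrZero W α)) (AlgPoints.continuousOn_evalOrZero W β) ?_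
      intro P hPW hPατ
      rw [Scheme.basicOpen_mul] at hPατ
      have hPT : P.pt ∈ T := (hτle hPατ.2).1
      have hPO : P.pt ∈ O i a := ⟨hPT, hWle' hPW⟩
      have hαP : evalOrZero W α P ≠ 0 := by
        rw [evalOrZero_of_mem _ hPW]
        exact (AlgPoints.pt_mem_basicOpen_iff P hPW α).1 hPατ.1
      -- `β ρ = c α` at `P` (from `β · r = c · α` in `K(X)`), and `c(P) = G(P) ρ(P)`
      have hval : evalOrZero W β P * ρ i a P = evalOrZero T c P * evalOrZero W α P := by
        rw [hρ_of_mem hPO]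
        refine evalOrZero_mul_eq_mul_of_ofSection β _ c α (P := P) hPW hPO hPT hPW ?_
        rw [ofSection_sectionOf]
        have e1 : ofSection (genericPoint_mem_of_mem hPW) β = algebraMap Γ(X.left, W) X.left.functionField β := rfl
        have e2 : ofSection (genericPoint_mem_of_mem hPW) α = algebraMap Γ(X.left, W) X.left.functionField α := rfl
        have e3 : ofSection (genericPoint_mem_of_mem hPT) c = hc' := rfl
        rw [e1, e2, e3]
        have := hr_ne i a
        rw [div_eq_div_iff this hαK] at hq
        -- hq : hc' * α = β * r
        rw [hq, mul_comm]
      rw [hc_val hPO] at hval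
      -- hval : β ρ = (G ρ) α  ⇒  β = G α  (ρ ≠ 0)
      have hρP : ρ i a P ≠ 0 := hρ_ne hPO
      have : evalOrZero W β P = G P * evalOrZero W α P := by
        apply mul_right_cancel₀ hρP
        rw [hval, hG]
        ring
      exact this.symm
    have hβ0 : β ≠ 0 := by
      intro hβ
      rw [hβ, map_zero, zero_div, div_eq_zero_iff] at hq
      exact hq.elim hc'_ne (hr_ne i a)
    -- Hartogs (the tree's `isUnitAt_div_of_continuousOn_eval`): `β/α = c/r` is a unit at `x`
    have hβK : algebraMap Γ(X.left, W) X.left.functionField β ≠ 0 :=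
      (RatFn.algebraMap_ne_zero_iff (X := X.left) (V := W)).2 hβ0
    have hαreg : ∀ y ∈ W, IsRegularAt y (algebraMap Γ(X.left, W) X.left.functionField α) := fun y hy ↦
      isRegularAt_ofSection hy α
    have hβreg : ∀ y ∈ W, IsRegularAt y (algebraMap Γ(X.left, W) X.left.functionField β) := fun y hy ↦
      isRegularAt_ofSection hy β
    have hsα : sectionOf hWgen (algebraMap Γ(X.left, W) X.left.functionField α) hαreg = α :=
      section_ext fun hU ↦ by rw [ofSection_sectionOf]; rfl
    have hsβ : sectionOf hWgen (algebraMap Γ(X.left, W) X.left.functionField β) hβreg = β :=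
      section_ext fun hU ↦ by rw [ofSection_sectionOf]; rfl
    rw [hq]
    refine isUnitAt_div_of_continuousOn_eval hregX hWgen hαK hβK hαreg hβreg hGcont hGne
      (fun P hP ↦ ?_) hxW
    rw [hsα, hsβ, ← evalOrZero_of_mem α hP, ← evalOrZero_of_mem β hP]
    exact hGαβ P hP
  /- assembly: `D ∼ D'` with `h = c⁻¹` -/
  refine (CartierDivisor.linEquiv_iff D D').2 ⟨hc'⁻¹, inv_ne_zero hc'_ne, fun i a x hi ha ↦ ?_⟩
  have h1 := (hunit i a x hi ha).inv
  rw [inv_div] at h1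
  -- `r / c = f_i c⁻¹ / f'_a`
  have e : D.f i * hc'⁻¹ / D'.f a = r i a / hc' := by
    simp only [hr]
    ring
  rw [e]
  exact h1

end Main

end Literature.AlgebraicGeometry.HodgeTheory
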